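import Literature.Analysis.FluidPDE.NavierStokesCorrectorAntidivergence
import Literature.Analysis.FluidPDE.TorusHeatLrEstimate
import Literature.Analysis.FluidPDE.NavierStokesConcentrationCorrectorFacts
import HarnessLib

/-!
# Discharge of `Torus.CheskidovLuo2022AntidivergenceBound` (Cheskidov–Luo 2022, Prop. 3.2, second estimate)

Analysis/FluidPDE proof file. The named fact `Torus.CheskidovLuo2022AntidivergenceBound`
(`NavierStokesConcentrationCorrectorFacts`; A. Cheskidov, X. Luo, *Sharp nonuniqueness for the
Navier–Stokes equations*, Invent. Math. 229 (2022) = arXiv:2009.06596, Prop. 3.2: "`‖ℛvᵢ‖_{L^∞L^r}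
≤ C_r ∫ ‖R‖_{L^r} + C_u δ τ^ε`", in the heat-flow form consumed by `Torus.IsCorrector`) is proved:

* the antidivergence `A` and the potential `π` with `v = div A + ∇π` are those of
  `Torus.exists_heatFlow_antidivergence` (`NavierStokesCorrectorAntidivergence`): the entries
  `Aₗⱼ` solve `∂ₜAₗⱼ = ΔAₗⱼ + φₗⱼ`, `Aₗⱼ(a) = 0`, with `|φₗⱼ| ≤ 2(‖R‖ + δ² + 2Mδ)`;
* the `L^r`-accretivity of the heat flow (`Torus.eLpNorm_le_integral_of_heat`,
  `TorusHeatLrEstimate`; the "standard energy method" of the printed proof) gives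
  `‖Aₗⱼ(t)‖_r ≤ ∫ₐᵗ ‖φₗⱼ‖_r ≤ 2 ∫ₐᵇ ‖R‖_r + 2(δ² + 2Mδ)(b - a)`;
* summing over the `d²` entries (`‖A(t, x)‖ ≤ ∑ⱼₗ |Aₗⱼ(t, x)|` for the column-sup norm),
  `‖A(t)‖_r ≤ C ∫ₐᵇ ‖R‖_r + C (δ + M) δ (b - a)` with `C = 4 d²`.

Main statement: `Torus.CheskidovLuo2022AntidivergenceBound_holds`.

## References

* A. Cheskidov, X. Luo, arXiv:2009.06596, Prop. 3.2 and its proof (p. 14–15). [`CheskidovLuo2022`]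
-/

open MeasureTheory Set Filter Topology
open scoped ENNReal ContDiff InnerProductSpace

noncomputable section

namespace Literature.Analysis.FluidPDE

namespace Torus

variable {d : Type*} [Fintype d] [DecidableEq d]

/-! ## Norm bookkeeping -/

section Norms

/-- The Euclidean norm is bounded by the `ℓ¹` norm of the coordinates. [folklore] -/
private theorem norm_le_sum_abs_coord (x : EuclideanSpace ℝ d) : ‖x‖ ≤ ∑ i, |x i| := by
  have hx : x = ∑ i, x i • EuclideanSpace.single i (1 : ℝ) := by
    conv_lhs => rw [← (EuclideanSpace.basisFun d ℝ).sum_repr x]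
    simp
  calc ‖x‖ = ‖∑ i, x i • EuclideanSpace.single i (1 : ℝ)‖ := by rw [← hx]
    _ ≤ ∑ i, ‖x i • EuclideanSpace.single i (1 : ℝ)‖ := norm_sum_le _ _
    _ = ∑ i, |x i| := by simp [norm_smul]

/-- The column-sup norm of a tensor is bounded by the sum of the absolute values of its entries. [folklore] -/
theorem norm_tensor_le_sum_abs (T : d → EuclideanSpace ℝ d) : ‖T‖ ≤ ∑ q : d × d, |T q.1 q.2| := by
  have h1 : ‖T‖ ≤ ∑ j, ‖T j‖ :=
    (pi_norm_le_iff_of_nonneg (Finset.sum_nonneg fun j _ => norm_nonneg _)).2 fun j =>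
      Finset.single_le_sum (f := fun j => ‖T j‖) (fun i _ => norm_nonneg _) (Finset.mem_univ j)
  calc ‖T‖ ≤ ∑ j, ‖T j‖ := h1
    _ ≤ ∑ j, ∑ l, |T j l| := Finset.sum_le_sum fun j _ => norm_le_sum_abs_coord (T j)
    _ = ∑ q : d × d, |T q.1 q.2| := by rw [Fintype.sum_prod_type]

omit [DecidableEq d] in
/-- On the probability space `𝕋^d`, `‖f‖_p ≤ 2‖R‖_p + 2c` when `|f| ≤ 2(‖R‖ + c)` pointwise
(`c ≥ 0`), in real numbers. [folklore] -/
theorem toReal_eLpNorm_le_of_abs_le {F : Type*} [NormedAddCommGroup F] {f : UnitAddTorus d → ℝ}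
    {R : UnitAddTorus d → F} {c : ℝ} (hc : 0 ≤ c) {p : ℝ≥0∞} (hp : 1 ≤ p) (hR : MemLp R p volume)
    (h : ∀ x, |f x| ≤ 2 * (‖R x‖ + c)) :
    (eLpNorm f p volume).toReal ≤ 2 * (eLpNorm R p volume).toReal + 2 * c := by
  have hRm : AEStronglyMeasurable R volume := hR.1
  -- pointwise domination by `g = 2‖R‖ + 2c`
  have h1 : eLpNorm f p volume ≤ eLpNorm (fun x => 2 * ‖R x‖ + 2 * c) p volume := by
    refine eLpNorm_mono_real fun x => ?_
    rw [Real.norm_eq_abs]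
    have h2 : 0 ≤ 2 * ‖R x‖ + 2 * c := by positivity
    calc |f x| ≤ 2 * (‖R x‖ + c) := h x
      _ = 2 * ‖R x‖ + 2 * c := by ring
  have h2 : eLpNorm (fun x => 2 * ‖R x‖ + 2 * c) p volume ≤
      eLpNorm (fun x => 2 * ‖R x‖) p volume + eLpNorm (fun _ : UnitAddTorus d => 2 * c) p volume :=
    eLpNorm_add_le (hRm.norm.const_mul 2) aestronglyMeasurable_const hp
  have h3 : eLpNorm (fun x => 2 * ‖R x‖) p volume = 2 * eLpNorm R p volume := by
    have : (fun x => 2 * ‖R x‖) = (2 : ℝ) • fun x => ‖R x‖ := by funext x; simp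
    rw [this, eLpNorm_const_smul, eLpNorm_norm, Real.enorm_eq_ofReal zero_le_two, ENNReal.ofReal_ofNat]
  have h4 : eLpNorm (fun _ : UnitAddTorus d => 2 * c) p volume = ENNReal.ofReal (2 * c) := by
    have hp0 : p ≠ 0 := (lt_of_lt_of_le zero_lt_one hp).ne'
    rw [eLpNorm_const _ hp0 (NeZero.ne _), measure_univ, ENNReal.one_rpow, mul_one,
      Real.enorm_eq_ofReal (by positivity)]
  have hfin : eLpNorm R p volume ≠ ⊤ := hR.eLpNorm_ne_top
  have htot : eLpNorm f p volume ≤ 2 * eLpNorm R p volume + ENNReal.ofReal (2 * c) := by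
    calc eLpNorm f p volume ≤ _ := h1
      _ ≤ _ := h2
      _ = _ := by rw [h3, h4]
  have hne : 2 * eLpNorm R p volume + ENNReal.ofReal (2 * c) ≠ ⊤ :=
    ENNReal.add_ne_top.2 ⟨ENNReal.mul_ne_top (by simp) hfin, ENNReal.ofReal_ne_top⟩
  have := ENNReal.toReal_mono hne htot
  rw [ENNReal.toReal_add (ENNReal.mul_ne_top (by simp) hfin) ENNReal.ofReal_ne_top,
    ENNReal.toReal_mul, ENNReal.toReal_ofReal (by positivity)] at this
  simpa using this

end Norms

/-! ## The named fact -/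

section Discharge

/-- **Discharge of `Torus.CheskidovLuo2022AntidivergenceBound`** (Cheskidov–Luo 2022, Prop. 3.2,
second estimate, heat-flow form): with `C = 4 d²`, for a divergence-free drift `u` (`‖u‖ ≤ M`), a
symmetric stress `R` and a solution `Torus.IsLinearizedNSSolutionOn u R a b v q` with `‖v‖ ≤ δ`,
the heat-flow antidivergence `A` and potential `π` of `Torus.exists_heatFlow_antidivergence`
satisfy `v = div A + ∇π` and `‖A(t)‖_{L^r} ≤ C ∫ₐᵇ ‖R‖_{L^r} + C (δ + M) δ (b - a)` for
`t ∈ [a, b]`: the entries obey `‖Aₗⱼ(t)‖_r ≤ ∫ₐᵗ ‖φₗⱼ‖_r` (`Torus.eLpNorm_le_integral_of_heat`,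
the "standard energy method" of the printed proof) with `‖φₗⱼ‖_r ≤ 2‖R‖_r + 2(δ² + 2Mδ)`, and
`‖A(t,x)‖ ≤ ∑ₗⱼ |Aₗⱼ(t,x)|`. [cite: CheskidovLuo2022, Prop. 3.2 (second estimate and its proof)] -/
theorem CheskidovLuo2022AntidivergenceBound_holds : CheskidovLuo2022AntidivergenceBound (d := d) := by
  intro hd r hr
  have hcard : (0 : ℝ) < Fintype.card d := by exact_mod_cast lt_of_lt_of_le two_pos hd
  refine ⟨4 * (Fintype.card d : ℝ) ^ 2, by positivity, ?_⟩
  intro a b hab u R v q M δ hu hudiv huM hR hRsym hsol hvδ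
  obtain ⟨A, π, φ, hA, hπ, hπ0, hsymm, htr, hident, hφ, hheat, hinit, hbound⟩ :=
    exists_heatFlow_antidivergence hab hu hudiv huM hR hRsym hsol.smooth_v hsol.smooth_q
      hsol.momentum hsol.divFree hsol.initial hvδ
  refine ⟨A, π, hA, hπ, hπ0, hsymm, htr, hident, fun t ht => ?_⟩
  -- notation and signs
  set p : ℝ≥0∞ := ENNReal.ofReal r with hp_def
  have hp1 : 1 ≤ p := by rw [hp_def]; simpa using hr.le
  have x0 : UnitAddTorus d := 0
  have hδ0 : 0 ≤ δ := (norm_nonneg _).trans (hvδ t ht x0)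
  have hM0 : 0 ≤ M := (norm_nonneg _).trans (huM t ht x0)
  set c : ℝ := δ ^ 2 + 2 * M * δ with hc_def
  have hc0 : 0 ≤ c := by positivity
  set G : ℝ → ℝ := fun s => (eLpNorm (R s) p volume).toReal with hG_def
  have hGc : ContinuousOn G (Icc a b) := hR.continuousOn_eLpNorm_toReal hp1
  have hG0 : ∀ s, 0 ≤ G s := fun s => ENNReal.toReal_nonneg
  have hat : a ≤ t := ht.1
  have htb : t ≤ b := ht.2
  -- the entries and their `L^r` bounds
  have hE : ∀ l j, FunctionSpaces.Torus.IsSmoothSpaceTimeOn (Icc a b) (fun s y => A s y j l) := fun l j =>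
    (hA.column j).apply l
  have hentry : ∀ l j, (eLpNorm (fun y => A t y j l) p volume).toReal ≤
      2 * (∫ s in a..b, G s) + 2 * c * (b - a) := by
    intro l j
    -- the energy estimate
    have h1 : (eLpNorm (fun y => A t y j l) p volume).toReal ≤
        ∫ s in a..t, (eLpNorm (φ l j s) p volume).toReal := by
      have h := eLpNorm_le_integral_of_heat (θ := fun s y => A s y j l) (g := φ l j) hab zero_le_one
        (hE l j) (hφ l j) (fun s hs y => by rw [one_mul]; exact hheat l j s hs y)
        (fun y => hinit l j y) hr ht
      simpa [hp_def] using h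
    -- the forcing bound in `L^r`
    have h2 : ∀ s ∈ Icc a b, (eLpNorm (φ l j s) p volume).toReal ≤ 2 * G s + 2 * c := fun s hs =>
      toReal_eLpNorm_le_of_abs_le hc0 hp1 ((hR.isSmooth_slice hs).memLp p) (hbound l j s hs)
    -- integrate
    have hφc : ContinuousOn (fun s => (eLpNorm (φ l j s) p volume).toReal) (Icc a b) :=
      (hφ l j).continuousOn_eLpNorm_toReal hp1
    have hBc : ContinuousOn (fun s => 2 * G s + 2 * c) (Icc a b) :=
      (hGc.const_smul (2 : ℝ)).add continuousOn_const
    have hBc' : ContinuousOn (fun s => 2 * G s + 2 * c) (uIcc a b) := by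
      rwa [uIcc_of_le hab.le]
    have h3 : ∫ s in a..t, (eLpNorm (φ l j s) p volume).toReal ≤ ∫ s in a..t, (2 * G s + 2 * c) := by
      refine intervalIntegral.integral_mono_on hat ?_ ?_ fun s hs => h2 s ⟨hs.1, hs.2.trans htb⟩
      · exact (hφc.mono (Icc_subset_Icc le_rfl htb)).intervalIntegrable_of_Icc hat
      · exact (hBc.mono (Icc_subset_Icc le_rfl htb)).intervalIntegrable_of_Icc hat
    have h4 : ∫ s in a..t, (2 * G s + 2 * c) ≤ ∫ s in a..b, (2 * G s + 2 * c) := by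
      refine intervalIntegral.integral_mono_interval le_rfl hat htb ?_ (hBc'.intervalIntegrable)
      exact Eventually.of_forall fun s => by have := hG0 s; positivity
    have h5 : ∫ s in a..b, (2 * G s + 2 * c) = 2 * (∫ s in a..b, G s) + 2 * c * (b - a) := by
      have hGi : IntervalIntegrable G volume a b := by
        refine ContinuousOn.intervalIntegrable ?_
        rwa [uIcc_of_le hab.le]
      rw [intervalIntegral.integral_add (hGi.const_mul 2) intervalIntegrable_const,
        intervalIntegral.integral_const_mul, intervalIntegral.integral_const, smul_eq_mul]
      ring
    linarith [h1, h3, h4, h5]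
  -- summing over the entries
  have hAt : FunctionSpaces.Torus.IsSmooth (A t) := hA.isSmooth_slice ht
  have hfin : ∀ q : d × d, eLpNorm (fun y => A t y q.1 q.2) p volume ≠ ⊤ := fun q =>
    (((hE q.2 q.1).isSmooth_slice ht).memLp p).eLpNorm_ne_top
  have hsum : eLpNorm (A t) p volume ≤ ∑ q : d × d, eLpNorm (fun y => A t y q.1 q.2) p volume := by
    have h1 : eLpNorm (A t) p volume ≤ eLpNorm (∑ q : d × d, fun y => |A t y q.1 q.2|) p volume := by
      refine eLpNorm_mono_real fun y => ?_
      rw [Finset.sum_apply]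
      exact norm_tensor_le_sum_abs (A t y)
    refine h1.trans ((eLpNorm_sum_le (fun q _ => ?_) hp1).trans (le_of_eq ?_))
    · exact (((hE q.2 q.1).isSmooth_slice ht).continuous.abs).aestronglyMeasurable
    · refine Finset.sum_congr rfl fun q _ => ?_
      have : (fun y => |A t y q.1 q.2|) = fun y => ‖A t y q.1 q.2‖ := by
        funext y; rw [Real.norm_eq_abs]
      rw [this, eLpNorm_norm]
  have hsum' : (eLpNorm (A t) p volume).toReal ≤
      ∑ q : d × d, (eLpNorm (fun y => A t y q.1 q.2) p volume).toReal := by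
    rw [← ENNReal.toReal_sum fun q _ => hfin q]
    exact ENNReal.toReal_mono (ENNReal.sum_ne_top.2 fun q _ => hfin q) hsum
  have htotal : (eLpNorm (A t) p volume).toReal ≤
      (Fintype.card d : ℝ) ^ 2 * (2 * (∫ s in a..b, G s) + 2 * c * (b - a)) := by
    calc (eLpNorm (A t) p volume).toReal
        ≤ ∑ q : d × d, (eLpNorm (fun y => A t y q.1 q.2) p volume).toReal := hsum'
      _ ≤ ∑ _q : d × d, (2 * (∫ s in a..b, G s) + 2 * c * (b - a)) :=
          Finset.sum_le_sum fun q _ => hentry q.2 q.1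
      _ = (Fintype.card d : ℝ) ^ 2 * (2 * (∫ s in a..b, G s) + 2 * c * (b - a)) := by
          rw [Finset.sum_const, Finset.card_univ, Fintype.card_prod, nsmul_eq_mul]
          push_cast
          ring
  -- the final constant
  have hI0 : 0 ≤ ∫ s in a..b, G s := intervalIntegral.integral_nonneg hab.le fun s _ => hG0 s
  have hba : 0 ≤ b - a := by linarith
  have hfinal : (eLpNorm (A t) p volume).toReal ≤
      4 * (Fintype.card d : ℝ) ^ 2 * (∫ s in a..b, G s) +
        4 * (Fintype.card d : ℝ) ^ 2 * ((δ + M) * δ * (b - a)) := by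
    have hcc : 2 * c ≤ 4 * ((δ + M) * δ) := by rw [hc_def]; nlinarith
    have hk : 0 ≤ (Fintype.card d : ℝ) ^ 2 := by positivity
    nlinarith [htotal, mul_le_mul_of_nonneg_left (mul_le_mul_of_nonneg_right hcc hba) hk]
  have hne : eLpNorm (A t) p volume ≠ ⊤ := (hAt.memLp p).eLpNorm_ne_top
  rw [← ENNReal.ofReal_toReal hne]
  exact ENNReal.ofReal_le_ofReal hfinal

/-- **The Cheskidov–Luo corrector fact follows from local solvability of (3.2) alone**: with the
antidivergence bound discharged, `Torus.CheskidovLuo2022Corrector` is reduced to the named fact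
`Torus.CheskidovLuo2022LocalExistence` (CL22 §3.1, "general local wellposedness theory").
[cite: CheskidovLuo2022, §3.1 (3.2) and Prop. 3.2] -/
theorem CheskidovLuo2022Corrector.of_localExistence (h : CheskidovLuo2022LocalExistence (d := d)) :
    CheskidovLuo2022Corrector (d := d) :=
  CheskidovLuo2022Corrector.of_localExistence_of_antidivergenceBound h
    CheskidovLuo2022AntidivergenceBound_holds

end Discharge

end Torus

end Literature.Analysis.FluidPDE
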